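import Literature.NumberTheory.Automorphic.UnitaryIwahoriOrbitalIntegralSplitTorus     -- ★ (ii) (F0P3a-p04): the Iwahori unit ratio (token form, ED. 2)
import Literature.NumberTheory.Automorphic.UnitaryOrbitalIntegralSimilitudeTransport   -- ★ (i) (B-p10): similitude transport `Φ(1_{K′}) = Φ(1_K)`, `ν K′ = ν K`
import HarnessLib

/-!
# The Euler–Poincaré combination vanishes at a regular DIAGONAL split-torus class of `U(Φ₂)(L⁺_v)` (relation (N) of the rank-one EP function)
(Kottwitz (1988) §2 Theorem 2: `O_γ(f_EP) = 0` for non-elliptic regular `γ`, `f_EP = ν(K)⁻¹1_K + ν(K′)⁻¹1_{K′} − ν(I)⁻¹1_I` on the tree of the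
rank-one group; Rogawski (1990) §12.6 p. 174: «`Φ(γ, f_π) = 0` if `γ ∈ G^r − G^e`»)

Topic `NumberTheory/Automorphic`; namespace `Literature.NumberTheory.Automorphic.UnitaryGroup`.  KERNEL mathematics only: one theorem, no
definition, no named fact, no instance, no notation, no `sorry`.  Cell `pub/hodgecm-mathlib`, crux H413 = `stmt-HodgeConjecture-24833`, line «N6nsGerm»,
stub `stub_N6nsR2EP : RankOneEulerPoincareNonsplit` ((R2)); the SUMMAND IDENTITY of the binder `hN` of the glue ★ B-p14
`exists_isLocSmooth_classOrbitalIntegral_eq_one_zero_of_relations` (p842588) at every regular DIAGONAL `γ`, assembled from ★ B-p10's similitude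
transport (i) and ★ F0P3a-p04's Iwahori-unit ratio (ii); EP pen B-p04 (g34), brick (β), seat F0P3a-p04 (g13).  HONEST LABEL: HC_CM is
proved only modulo the printed citations until rung 0 closes; nothing printed is asserted here.

THE MATHEMATICS.  `U₂ = U(Φ₂)(L⁺_v)`, `w ∣ v` non-split, `ϖ` a `σ_w`-fixed unit of `L_w` (a uniformiser of `L⁺_v` in the application; only
`σ_w ϖ = ϖ` is used), `d = diag(1, ϖ)`; the three levels are given by their ONE-PLACE memberships (B-p10's road ★ `IwahoriGLTwoVertexStabilizers`):
`K = {u | u_w ∈ GL₂(𝒪_w)}`, `K′ = {u | u_w ∈ d GL₂(𝒪_w) d⁻¹}`, `I = {u | u_w ∈ Iw}` (`Iw` the upper Iwahori), `I` open.  For a canonical family `m`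
(for `IsRegularElt`, Haar `ν`) and a regular diagonal `γ = diag(d₀, d₁)`:
**`ν(K)⁻¹Φ(⟦γ⟧,1_K) + ν(K′)⁻¹Φ(⟦γ⟧,1_{K′}) − ν(I)⁻¹Φ(⟦γ⟧,1_I) = 0`** (`ℂ`-valued units, `((ν ·).toReal : ℂ)⁻¹` weights — the glue's tokens).
Proof: `Φ(1_{K′})(γ) = Φ(1_K)(d⁻¹γ_w d) = Φ(1_K)(γ)` (★ (i) `…_of_commute`, `d` and `γ_w` diagonal) and `ν K′ = ν K` (★ `measure_setOf_coe_mem_map_conj_eq`),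
`ν(I)⁻¹Φ(1_I) = 2ν(K)⁻¹Φ(1_K)` (★ (ii) `inv_measure_mul_classOrbitalIntegral_iwahoriGL_eq_two_mul_of_torus_regular`); then `ring`.
NOT here: the reduction of a general regular element with non-compact centraliser to a diagonal one (B-p14 (g-D)), the elliptic relation (E),
the assembly of ★ `RankOneEulerPoincareNonsplit` (EP pen).

## References
* [Kottwitz1988] R. E. Kottwitz, *Tamagawa numbers*, Ann. of Math. 127 (1988), §2 Theorem 2.
* [Rogawski1990] J. D. Rogawski, *Automorphic Representations of Unitary Groups in Three Variables*, Ann. of Math. Stud. 123 (1990), §12.6 p. 174; §4.9 (4.9.2) p. 55.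
-/

set_option autoImplicit false

noncomputable section

open MeasureTheory Measure Set NumberField IsDedekindDomain
open scoped ENNReal NNReal Matrix MatrixGroups

namespace Literature.NumberTheory.Automorphic.UnitaryGroup

open Literature.NumberTheory.Rogawski1990 (IsRegularElt)
open Literature.NumberTheory.Automorphic

variable (L : Type) [Field L] [NumberField L] [IsCMField L] {v : HeightOneSpectrum (𝓞 ↥(maximalRealSubfield L))}

/-- **RELATION (N) OF THE RANK-ONE EULER–POINCARÉ FUNCTION AT A REGULAR DIAGONAL CLASS of `U₂ = U(Φ₂)(L⁺_v)`**: with `K`, `K′ = dKd⁻¹` (`d = diag(1, ϖ)`,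
`σ_w ϖ = ϖ`) and an open `I` given by their one-place memberships (`GL₂(𝒪_w)`, `d GL₂(𝒪_w) d⁻¹`, the upper Iwahori), `m` canonical for `(IsRegularElt, ν)`
and `γ = diag(d₀, d₁)` regular:
`((ν K).toReal)⁻¹·Φ(⟦γ⟧,1_K) + ((ν K′).toReal)⁻¹·Φ(⟦γ⟧,1_{K′}) − ((ν I).toReal)⁻¹·Φ(⟦γ⟧,1_I) = 0` — the summand of the glue's `hN` (★ p842588).
[cite: Kottwitz1988, §2 Theorem 2] [cite: Rogawski1990, §12.6 p. 174; §4.9 (4.9.2) p. 55] -/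
theorem epCombination_classOrbitalIntegral_eq_zero_of_torus_regular
    (w : PlacesOver L v) (hw : IsCMField.complexConj L • w.1 = w.1)
    [MeasurableSpace ((cmDatum L 2 (Matrix.of fun i j : Fin 2 => if i.val + j.val + 1 = 2 then (1 : L) else 0)).Local v)] [BorelSpace ((cmDatum L 2 (Matrix.of fun i j : Fin 2 => if i.val + j.val + 1 = 2 then (1 : L) else 0)).Local v)]
    [∀ a : ((cmDatum L 2 (Matrix.of fun i j : Fin 2 => if i.val + j.val + 1 = 2 then (1 : L) else 0)).Local v), MeasurableSpace (((cmDatum L 2 (Matrix.of fun i j : Fin 2 => if i.val + j.val + 1 = 2 then (1 : L) else 0)).Local v) ⧸ Subgroup.centralizer ({a} : Set ((cmDatum L 2 (Matrix.of fun i j : Fin 2 => if i.val + j.val + 1 = 2 then (1 : L) else 0)).Local v)))]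
    [∀ a : ((cmDatum L 2 (Matrix.of fun i j : Fin 2 => if i.val + j.val + 1 = 2 then (1 : L) else 0)).Local v), BorelSpace (((cmDatum L 2 (Matrix.of fun i j : Fin 2 => if i.val + j.val + 1 = 2 then (1 : L) else 0)).Local v) ⧸ Subgroup.centralizer ({a} : Set ((cmDatum L 2 (Matrix.of fun i j : Fin 2 => if i.val + j.val + 1 = 2 then (1 : L) else 0)).Local v)))]
    (ν : Measure ((cmDatum L 2 (Matrix.of fun i j : Fin 2 => if i.val + j.val + 1 = 2 then (1 : L) else 0)).Local v)) [ν.IsHaarMeasure] [ν.IsMulRightInvariant]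
    {m : OrbitalMeasureFamily ((cmDatum L 2 (Matrix.of fun i j : Fin 2 => if i.val + j.val + 1 = 2 then (1 : L) else 0)).Local v)}
    (hm : m.IsCanonical (fun γ => IsRegularElt (γ.val : GL (Fin 2) (LocalRing L v))) ν)
    (ϖ : (w.1.adicCompletion L)ˣ) (hσϖ : galAdicCompletionMap (L := L) (IsCMField.complexConj L) hw (ϖ : w.1.adicCompletion L) = ϖ)
    (K K' I : Subgroup ((cmDatum L 2 (Matrix.of fun i j : Fin 2 => if i.val + j.val + 1 = 2 then (1 : L) else 0)).Local v))
    (hK : ∀ u : ((cmDatum L 2 (Matrix.of fun i j : Fin 2 => if i.val + j.val + 1 = 2 then (1 : L) else 0)).Local v), u ∈ K ↔ ((localNonsplitEquiv (IsCMField.complexConj L) (Matrix.of fun i j : Fin 2 => if i.val + j.val + 1 = 2 then (1 : L) else 0) (IsCMField.complexConj_ne_one L) w hw u : ↥(unitaryGroupOfForm (galAdicCompletionMap (L := L) (IsCMField.complexConj L) hw) (placeForm (Matrix.of fun i j : Fin 2 => if i.val + j.val + 1 = 2 then (1 : L) else 0) w.1))) : GL (Fin 2) (w.1.adicCompletion L))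 ∈ glInt 2 (w.1.adicCompletion L))
    (hK' : ∀ u : ((cmDatum L 2 (Matrix.of fun i j : Fin 2 => if i.val + j.val + 1 = 2 then (1 : L) else 0)).Local v), u ∈ K' ↔ ((localNonsplitEquiv (IsCMField.complexConj L) (Matrix.of fun i j : Fin 2 => if i.val + j.val + 1 = 2 then (1 : L) else 0) (IsCMField.complexConj_ne_one L) w hw u : ↥(unitaryGroupOfForm (galAdicCompletionMap (L := L) (IsCMField.complexConj L) hw) (placeForm (Matrix.of fun i j : Fin 2 => if i.val + j.val + 1 = 2 then (1 : L) else 0) w.1))) : GL (Fin 2) (w.1.adicCompletion L)) ∈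
      (glInt 2 (w.1.adicCompletion L)).map (MulAut.conj (glDiagonal 2 (w.1.adicCompletion L) ![1, ϖ])).toMonoidHom)
    (hIo : IsOpen (I : Set ((cmDatum L 2 (Matrix.of fun i j : Fin 2 => if i.val + j.val + 1 = 2 then (1 : L) else 0)).Local v)))
    (hIw : ∀ u : ((cmDatum L 2 (Matrix.of fun i j : Fin 2 => if i.val + j.val + 1 = 2 then (1 : L) else 0)).Local v), u ∈ I ↔ ((localNonsplitEquiv (IsCMField.complexConj L) (Matrix.of fun i j : Fin 2 => if i.val + j.val + 1 = 2 then (1 : L) else 0) (IsCMField.complexConj_ne_one L) w hw u : ↥(unitaryGroupOfForm (galAdicCompletionMap (L := L) (IsCMField.complexConj L) hw) (placeForm (Matrix.of fun i j : Fin 2 => if i.val + j.val + 1 = 2 then (1 : L) else 0) w.1))) : GL (Fin 2) (w.1.adicCompletion L)) ∈ iwahoriGL 2 (w.1.adicCompletion L))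
    {γ : ((cmDatum L 2 (Matrix.of fun i j : Fin 2 => if i.val + j.val + 1 = 2 then (1 : L) else 0)).Local v)} (hreg : IsRegularElt (γ.val : GL (Fin 2) (LocalRing L v)))
    {d : Fin 2 → (LocalRing L v)ˣ} (hd : glDiagonal 2 (LocalRing L v) d = (γ.val : GL (Fin 2) (LocalRing L v)))
    (hb : IsUnit ((((d 0)⁻¹ * d 1 : (LocalRing L v)ˣ) : LocalRing L v) - 1)) :
    (((ν K).toReal : ℂ))⁻¹ * classOrbitalIntegral m ((K : Set ((cmDatum L 2 (Matrix.of fun i j : Fin 2 => if i.val + j.val + 1 = 2 then (1 : L) else 0)).Local v)).indicator fun _ => (1 : ℂ)) (ConjClasses.mk γ) +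
        (((ν K').toReal : ℂ))⁻¹ * classOrbitalIntegral m ((K' : Set ((cmDatum L 2 (Matrix.of fun i j : Fin 2 => if i.val + j.val + 1 = 2 then (1 : L) else 0)).Local v)).indicator fun _ => (1 : ℂ)) (ConjClasses.mk γ) -
        (((ν I).toReal : ℂ))⁻¹ * classOrbitalIntegral m ((I : Set ((cmDatum L 2 (Matrix.of fun i j : Fin 2 => if i.val + j.val + 1 = 2 then (1 : L) else 0)).Local v)).indicator fun _ => (1 : ℂ)) (ConjClasses.mk γ) = 0 := by
  haveI : Algebra.IsQuadraticExtension ↥(maximalRealSubfield L) L := IsCMField.isQuadraticExtension L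
  -- the levels as one-place sets; `K` IS the hyperspecial level `K_v`
  have hKset : (K : Set ((cmDatum L 2 (Matrix.of fun i j : Fin 2 => if i.val + j.val + 1 = 2 then (1 : L) else 0)).Local v)) = {u : ((cmDatum L 2 (Matrix.of fun i j : Fin 2 => if i.val + j.val + 1 = 2 then (1 : L) else 0)).Local v) | ((localNonsplitEquiv (IsCMField.complexConj L) (Matrix.of fun i j : Fin 2 => if i.val + j.val + 1 = 2 then (1 : L) else 0) (IsCMField.complexConj_ne_one L) w hw u : ↥(unitaryGroupOfForm (galAdicCompletionMap (L := L) (IsCMField.complexConj L) hw) (placeForm (Matrix.of fun i j : Fin 2 => if i.val + j.val + 1 = 2 then (1 : L) else 0) w.1))) : GL (Fin 2) (w.1.adicCompletion L)) ∈ glInt 2 (w.1.adicCompletion L)} := Set.ext fun u => hK u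
  have hK'set : (K' : Set ((cmDatum L 2 (Matrix.of fun i j : Fin 2 => if i.val + j.val + 1 = 2 then (1 : L) else 0)).Local v)) = {u : ((cmDatum L 2 (Matrix.of fun i j : Fin 2 => if i.val + j.val + 1 = 2 then (1 : L) else 0)).Local v) | ((localNonsplitEquiv (IsCMField.complexConj L) (Matrix.of fun i j : Fin 2 => if i.val + j.val + 1 = 2 then (1 : L) else 0) (IsCMField.complexConj_ne_one L) w hw u : ↥(unitaryGroupOfForm (galAdicCompletionMap (L := L) (IsCMField.complexConj L) hw) (placeForm (Matrix.of fun i j : Fin 2 => if i.val + j.val + 1 = 2 then (1 : L) else 0) w.1))) : GL (Fin 2) (w.1.adicCompletion L)) ∈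
      (glInt 2 (w.1.adicCompletion L)).map (MulAut.conj (glDiagonal 2 (w.1.adicCompletion L) ![1, ϖ])).toMonoidHom} := Set.ext fun u => hK' u
  have hKlvl : K = (cmLocalIntegralLevel L 2 (Matrix.of fun i j : Fin 2 => if i.val + j.val + 1 = 2 then (1 : L) else 0) v) :=
    Subgroup.ext fun u => (hK u).trans (mem_localIntegralLevel_iff_of_smul_eq (IsCMField.complexConj L) 2 _ (IsCMField.complexConj_ne_one L) w hw u).symm
  -- (i) the similitude `d = diag(1, ϖ)` commutes with the diagonal `γ_w`: `Φ(1_{K′})(γ) = Φ(1_K)(γ)` and `ν K′ = ν K`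
  have hform := formCongr_glDiagonal_one_eq_smul_placeForm_antidiag L w hw ϖ hσϖ
  have hcomm : Commute (glDiagonal 2 (w.1.adicCompletion L) ![1, ϖ]) ((localNonsplitEquiv (IsCMField.complexConj L) (Matrix.of fun i j : Fin 2 => if i.val + j.val + 1 = 2 then (1 : L) else 0) (IsCMField.complexConj_ne_one L) w hw γ : ↥(unitaryGroupOfForm (galAdicCompletionMap (L := L) (IsCMField.complexConj L) hw) (placeForm (Matrix.of fun i j : Fin 2 => if i.val + j.val + 1 = 2 then (1 : L) else 0) w.1))) : GL (Fin 2) (w.1.adicCompletion L)) := by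
    rw [← Commute.units_val_iff, coe_glDiagonal, coe_coe_localNonsplitEquiv_apply, ← hd, coe_glDiagonal,
      Matrix.diagonal_map (RingHom.map_zero (Pi.evalRingHom (fun w' : PlacesOver L v => w'.1.adicCompletion L) w))]
    exact (Matrix.diagonal_mul_diagonal _ _).trans ((Matrix.diagonal_mul_diagonal _ _).trans (by simp_rw [mul_comm])).symm
  have hΦK' : classOrbitalIntegral m ((K' : Set ((cmDatum L 2 (Matrix.of fun i j : Fin 2 => if i.val + j.val + 1 = 2 then (1 : L) else 0)).Local v)).indicator fun _ => (1 : ℂ)) (ConjClasses.mk γ) =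
      classOrbitalIntegral m ((K : Set ((cmDatum L 2 (Matrix.of fun i j : Fin 2 => if i.val + j.val + 1 = 2 then (1 : L) else 0)).Local v)).indicator fun _ => (1 : ℂ)) (ConjClasses.mk γ) := by
    rw [hK'set, hKset]
    exact classOrbitalIntegral_indicator_setOf_coe_mem_map_conj_eq_of_commute L 2 _ w hw _ ϖ.isUnit hform ν hσϖ hm _ γ hreg hcomm
  have hνK' : ν (K' : Set ((cmDatum L 2 (Matrix.of fun i j : Fin 2 => if i.val + j.val + 1 = 2 then (1 : L) else 0)).Local v)) = ν (K : Set ((cmDatum L 2 (Matrix.of fun i j : Fin 2 => if i.val + j.val + 1 = 2 then (1 : L) else 0)).Local v)) := by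
    rw [hK'set, hKset]
    exact measure_setOf_coe_mem_map_conj_eq L 2 _ w hw _ ϖ.isUnit hform ν hσϖ _
  -- (ii) the Iwahori unit ratio
  have hI := inv_measure_mul_classOrbitalIntegral_iwahoriGL_eq_two_mul_of_torus_regular L w hw ν hm I hIo hIw hreg hd hb
  rw [hΦK', hνK', hI, hKlvl]
  ring

end Literature.NumberTheory.Automorphic.UnitaryGroup

end
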